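import Mathlib
import Summits.AtomisticToContinuum.HydrodynamicLimit.Theses.OneFlightGossipEngine

/-!
# Sketch — crux-ideate stmt-AtomisticToContinuum-0766 (RelEntropyVanishing), round 1, ideator 1

First checkable statements of the idea card `lazy-gossip-nondegeneracy`.

* `lazy_gossip_pointwise` (PROVED): the traceless `e ⊗ e`-tested second moment of a pair after a
  hard-sphere/Kac collision `(V + h ω, V - h ω)` splits EXACTLY into the gossip value (both
  velocities replaced by the pair mean `V`) plus `2 h² (⟪ω,e⟫² - ‖ω‖²‖e‖²/3)`.
* `before_sub_gossip` (PROVED): the same excess before the collision is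
  `(1/2)(⟪g,e⟫² - ‖g‖²‖e‖²/3)`, `g` the relative velocity.
  Consequence (card): if the conditional kick law is axisymmetric about `ĝ` with quadrupole
  amplitude `q = E[P₂(ω·ĝ)]`, then `E[after] = (1 - q)·gossip + q·before` — a LAZY gossip step.
* `LazyGossipStep`, `PairHeatFluxLazyDamping` (typed Props): the measure-level statements.
* `QuadrupoleBoundOfDensityBound` (typed Prop, real analysis): an impact-parameter density
  bounded by `C`·uniform forces `q ≤ 1 - η(C)`.
* `TaggedStressResponseDecay` (typed Prop over the hard-sphere flow): Cesàro decay, uniformly in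
  `N`, of the equilibrium response of the total kinetic shear stress to one tagged particle's
  initial stress; `ResponseDecayGivesRung : Prop` records the (provable-now) implication to the
  route rung `EquilibriumStressVarianceDecay` (stmt-9531).
-/

namespace Summit.AtomisticToContinuum.HydrodynamicLimit.Cruxes.RelEntropyVanishing.IdeatorOne

open scoped BigOperators ENNReal
open MeasureTheory Filter
open Literature.MathematicalPhysics.KineticTheory

local notation "⟪" x ", " y "⟫" => @inner ℝ _ _ x y

/-- EXACT ONE-COLLISION SPLITTING (pointwise in the kick `ω`, any real inner product space):
`⟪V+hω,e⟫² + ⟪V-hω,e⟫² - (‖V+hω‖²+‖V-hω‖²)‖e‖²/3 = [2⟪V,e⟫² - 2‖V‖²‖e‖²/3] + 2h²[⟪ω,e⟫² - ‖ω‖²‖e‖²/3]`.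
Norms are written as self inner products. [folklore] -/
theorem lazy_gossip_pointwise {E : Type*} [NormedAddCommGroup E] [InnerProductSpace ℝ E]
    (V ω e : E) (h : ℝ) :
    ⟪V + h • ω, e⟫ ^ 2 + ⟪V - h • ω, e⟫ ^ 2
        - (⟪V + h • ω, V + h • ω⟫ + ⟪V - h • ω, V - h • ω⟫) * ⟪e, e⟫ / 3
      = (2 * ⟪V, e⟫ ^ 2 - 2 * ⟪V, V⟫ * ⟪e, e⟫ / 3)
        + 2 * h ^ 2 * (⟪ω, e⟫ ^ 2 - ⟪ω, ω⟫ * ⟪e, e⟫ / 3) := by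
  simp only [inner_add_left, inner_add_right, inner_sub_left, inner_sub_right,
    real_inner_smul_left, real_inner_smul_right]
  have hc : ⟪ω, V⟫ = ⟪V, ω⟫ := real_inner_comm _ _
  rw [hc]
  ring

/-- The excess of the pre-collisional pair second moment over the gossip value:
for `v = V + (1/2)g`, `w = V - (1/2)g`,
`⟪v,e⟫² + ⟪w,e⟫² - (‖v‖²+‖w‖²)‖e‖²/3 - [2⟪V,e⟫² - 2‖V‖²‖e‖²/3] = (1/2)(⟪g,e⟫² - ‖g‖²‖e‖²/3)`.
[folklore] -/
theorem before_sub_gossip {E : Type*} [NormedAddCommGroup E] [InnerProductSpace ℝ E]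
    (V g e : E) :
    ⟪V + (1/2 : ℝ) • g, e⟫ ^ 2 + ⟪V - (1/2 : ℝ) • g, e⟫ ^ 2
        - (⟪V + (1/2 : ℝ) • g, V + (1/2 : ℝ) • g⟫ + ⟪V - (1/2 : ℝ) • g, V - (1/2 : ℝ) • g⟫)
          * ⟪e, e⟫ / 3
        - (2 * ⟪V, e⟫ ^ 2 - 2 * ⟪V, V⟫ * ⟪e, e⟫ / 3)
      = (1/2 : ℝ) * (⟪g, e⟫ ^ 2 - ⟪g, g⟫ * ⟪e, e⟫ / 3) := by
  have := lazy_gossip_pointwise V g e (1/2 : ℝ)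
  rw [this]
  ring

/-- LAZY GOSSIP STEP (typed). For a probability law `ν` on `V3` carried by the unit sphere whose
second moments are AXISYMMETRIC about the unit vector `ĝ` with `a = ∫⟪ω,ĝ⟫² dν`
(so `∫⟪ω,e⟫² dν = a⟪ĝ,e⟫² + (1-a)/2 (‖e‖² - ⟪ĝ,e⟫²)`), the `ν`-average of the pair's traceless
tested second moment after the kick `(V ± h ω)` equals `(1-q)·gossip + q·before` with
`q = (3a-1)/2 ∈ [-1/2, 1]`, where `before` is computed for the incoming pair `V ± h ĝ`.
Consequence of `lazy_gossip_pointwise` + `before_sub_gossip` + linearity of the integral. -/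
def LazyGossipStep : Prop :=
  ∀ (ν : Measure V3) [IsProbabilityMeasure ν] (ghat : V3) (a : ℝ), ‖ghat‖ = 1 →
    (∀ᵐ ω ∂ν, ‖ω‖ = 1) →
    (∀ e : V3, ∫ ω, ⟪ω, e⟫ ^ 2 ∂ν = a * ⟪ghat, e⟫ ^ 2 + (1 - a) / 2 * (‖e‖ ^ 2 - ⟪ghat, e⟫ ^ 2)) →
    ∀ (V e : V3) (h : ℝ),
      ∫ ω, (⟪V + h • ω, e⟫ ^ 2 + ⟪V - h • ω, e⟫ ^ 2
              - (‖V + h • ω‖ ^ 2 + ‖V - h • ω‖ ^ 2) * ‖e‖ ^ 2 / 3) ∂ν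
        = (1 - (3 * a - 1) / 2) * (2 * ⟪V, e⟫ ^ 2 - 2 * ‖V‖ ^ 2 * ‖e‖ ^ 2 / 3)
          + (3 * a - 1) / 2 * (⟪V + h • ghat, e⟫ ^ 2 + ⟪V - h • ghat, e⟫ ^ 2
              - (‖V + h • ghat‖ ^ 2 + ‖V - h • ghat‖ ^ 2) * ‖e‖ ^ 2 / 3)

/-- PAIR HEAT-FLUX LAZY DAMPING (typed; the lazy version of the route support `KacPairHeatFlux`,
stmt-9534). Independent mean-zero inputs `x ∼ μ`, `y ∼ μ'` with third moments; a kick law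
`ν g` on the unit sphere, measurably depending on the relative velocity `g = x - y`, axisymmetric
about `ĝ` in its first two moments with `∫⟪ω,ĝ⟫² d(ν g) = a` CONSTANT (any fore–aft dipole
`∫⟪ω,ĝ⟫ d(ν g)` allowed): the expected heat flux of the PAIR after the collision is damped by
exactly `(1 + a)/2` (`= 2/3` for isotropic kicks, `< 1` unless the kick is a.s. `±ĝ`). -/
def PairHeatFluxLazyDamping : Prop :=
  ∀ (μ μ' : Measure V3) (ν : V3 → Measure V3) (a : ℝ), IsProbabilityMeasure μ →
    IsProbabilityMeasure μ' → (∀ g, IsProbabilityMeasure (ν g)) →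
    Integrable (fun x => ‖x‖ ^ 3) μ → Integrable (fun y => ‖y‖ ^ 3) μ' →
    ∫ x, x ∂μ = 0 → ∫ y, y ∂μ' = 0 →
    (∀ g, ∀ᵐ ω ∂(ν g), ‖ω‖ = 1) →
    (∀ g, g ≠ 0 → ∫ ω, ω ∂(ν g) = (∫ ω, ⟪ω, ‖g‖⁻¹ • g⟫ ∂(ν g)) • (‖g‖⁻¹ • g)) →
    (∀ g, g ≠ 0 → ∀ e : V3, ∫ ω, ⟪ω, e⟫ ^ 2 ∂(ν g)
        = a * ⟪‖g‖⁻¹ • g, e⟫ ^ 2 + (1 - a) / 2 * (‖e‖ ^ 2 - ⟪‖g‖⁻¹ • g, e⟫ ^ 2)) →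
    (∀ s : Set V3, MeasurableSet s → Measurable fun g => ν g s) →
    ∀ e : V3,
      ∫ x, ∫ y, ∫ ω, (⟪(1/2 : ℝ) • (x + y) + (‖x - y‖ / 2) • ω, e⟫
                        * ‖(1/2 : ℝ) • (x + y) + (‖x - y‖ / 2) • ω‖ ^ 2
                      + ⟪(1/2 : ℝ) • (x + y) - (‖x - y‖ / 2) • ω, e⟫
                        * ‖(1/2 : ℝ) • (x + y) - (‖x - y‖ / 2) • ω‖ ^ 2) ∂(ν (x - y)) ∂μ' ∂μ
        = (1 + a) / 2 * ((∫ x, ⟪x, e⟫ * ‖x‖ ^ 2 ∂μ) + ∫ y, ⟪y, e⟫ * ‖y‖ ^ 2 ∂μ')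

/-- QUADRUPOLE BOUND FROM A DENSITY BOUND (typed, real analysis). Parametrise the impact
parameter of a hard-sphere collision by `s = b²/ε² ∈ [0,1]` (uniform `b` on the disc ⟺ uniform
`s`); the scattering cosine is `cos χ = 2s - 1` and the kick quadrupole of a radial law with
density `ρ` is `q = ∫₀¹ P₂(2s-1) ρ(s) ds`. If `ρ ≤ C`, then `q ≤ 1 - η(C)` with `η(C) > 0`:
the conditional scattering law cannot concentrate on grazing/head-on collisions. -/
def QuadrupoleBoundOfDensityBound : Prop :=
  ∀ C : ℝ, 1 ≤ C → ∃ η : ℝ, 0 < η ∧ ∀ ρ : ℝ → ℝ, Measurable ρ → (∀ s, 0 ≤ ρ s ∧ ρ s ≤ C) →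
    ∫ s in (0 : ℝ)..1, ρ s = 1 →
      ∫ s in (0 : ℝ)..1, (3 * (2 * s - 1) ^ 2 - 1) / 2 * ρ s ≤ 1 - η

/-- TAGGED STRESS RESPONSE DECAY (typed crux-level statement; the first-moment core of the route
rung `EquilibriumStressVarianceDecay`, stmt-9531). Equilibrium (`a₀`, `u₀ = 0`, `θ₀` constant;
the canonical law is flow-invariant), `w_N = τ (N+1)^{-1/3}` a kinetic window; response function
`R_N(s) = E[φ(x₀(0)) v₀¹v₀²(0) · Σ_i φ(x_i(s)) v_i¹ v_i²(s)]`; claim: its Fejér (triangular-kernel)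
window average `(2/w²)∫₀^w (w-s) R_N(s) ds` tends to `0` as `τ → ∞` uniformly in `N` (limsup in
`N` first). By stationarity of the canonical law and exchangeability this expression EQUALS
`(N+1)·E[Ȳ_τ²]` of stmt-9531, so the statement is the first-moment (linear-response) form of the
rung, not a weakening; it is typed because the card's lever bounds `R_N` (`ResponseDecayGivesRung`
is the provable-now identity). -/
def TaggedStressResponseDecay : Prop :=
  ∀ (a₀ θ₀ : ℝ), 0 < a₀ → 0 < θ₀ → ∃ σ₀ : ℝ, 0 < σ₀ ∧ ∀ σ : ℝ, 0 < σ → σ < σ₀ →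
    ∀ Φ : (N : ℕ) → Literature.Analysis.FluidPDE.HardSphereFlow
        (Literature.Analysis.FluidPDE.Torus.geometry (Fin 3)) (hsDiameter σ N) (N + 1),
    ∀ φ : T3 → ℝ, Continuous φ →
      Tendsto (fun τ : ℝ => limsup (fun N : ℕ =>
        |2 * ((τ * ((N : ℝ) + 1) ^ (-(1 / 3 : ℝ))) ^ 2)⁻¹ *
          ∫ s in (0 : ℝ)..(τ * ((N : ℝ) + 1) ^ (-(1 / 3 : ℝ))),
            (τ * ((N : ℝ) + 1) ^ (-(1 / 3 : ℝ)) - s) *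
            ∫ z, (φ (z 0).1 * ((z 0).2 0 * (z 0).2 1)) *
                  (∑ i : Fin (N + 1), φ ((Φ N).flow s z i).1 *
                    (((Φ N).flow s z i).2 0 * ((Φ N).flow s z i).2 1))
              ∂(localGibbsLaw σ (fun _ => a₀) (fun _ => 0) (fun _ => θ₀) N (Φ N))|)
        atTop) atTop (nhds 0)

/-- The (provable-now) implication from the response decay to the route rung stmt-9531
(stationarity of the canonical law under the flow + exchangeability + `Var = ∫∫ Cov`). -/
def ResponseDecayGivesRung : Prop :=
  TaggedStressResponseDecay →
    Summit.AtomisticToContinuum.HydrodynamicLimit.Theses.OneFlightGossipEngine.EquilibriumStressVarianceDecay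

end Summit.AtomisticToContinuum.HydrodynamicLimit.Cruxes.RelEntropyVanishing.IdeatorOne

namespace Summit.AtomisticToContinuum.HydrodynamicLimit.Cruxes.RelEntropyVanishing.IdeatorOne

open MeasureTheory
open Literature.MathematicalPhysics.KineticTheory

local notation "⟪" x ", " y "⟫" => @inner ℝ _ _ x y

/-- Norm form of `lazy_gossip_pointwise` on the unit sphere. -/
theorem lazy_gossip_pointwise_norm (V ω e : V3) (h : ℝ) (hω : ‖ω‖ = 1) :
    ⟪V + h • ω, e⟫ ^ 2 + ⟪V - h • ω, e⟫ ^ 2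
        - (‖V + h • ω‖ ^ 2 + ‖V - h • ω‖ ^ 2) * ‖e‖ ^ 2 / 3
      = (2 * ⟪V, e⟫ ^ 2 - 2 * ‖V‖ ^ 2 * ‖e‖ ^ 2 / 3)
        + 2 * h ^ 2 * (⟪ω, e⟫ ^ 2 - ‖e‖ ^ 2 / 3) := by
  have key := lazy_gossip_pointwise V ω e h
  simp only [real_inner_self_eq_norm_sq, hω, one_pow, one_mul] at key
  linarith [key]

/-- `LazyGossipStep` HOLDS: the lazy gossip step is a theorem (linearity of the integral over the
pointwise identity). -/
theorem lazyGossipStep_holds : LazyGossipStep := by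
  intro ν _ ghat a hg hsph hmom V e h
  have hint : Integrable (fun ω : V3 => ⟪ω, e⟫ ^ 2) ν := by
    refine Integrable.mono' (integrable_const (‖e‖ ^ 2)) ?_ ?_
    · exact (Continuous.pow (continuous_id.inner continuous_const) 2).aestronglyMeasurable
    · filter_upwards [hsph] with ω hω
      rw [Real.norm_eq_abs, abs_of_nonneg (sq_nonneg _)]
      have h1 : |⟪ω, e⟫| ≤ ‖ω‖ * ‖e‖ := abs_real_inner_le_norm ω e
      rw [hω, one_mul] at h1
      have h2 : ⟪ω, e⟫ ^ 2 = |⟪ω, e⟫| ^ 2 := (sq_abs _).symm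
      rw [h2]
      exact pow_le_pow_left₀ (abs_nonneg _) h1 2
  have hae : (fun ω : V3 => ⟪V + h • ω, e⟫ ^ 2 + ⟪V - h • ω, e⟫ ^ 2
        - (‖V + h • ω‖ ^ 2 + ‖V - h • ω‖ ^ 2) * ‖e‖ ^ 2 / 3)
      =ᵐ[ν] (fun ω : V3 => (2 * ⟪V, e⟫ ^ 2 - 2 * ‖V‖ ^ 2 * ‖e‖ ^ 2 / 3 - 2 * h ^ 2 * (‖e‖ ^ 2 / 3))
        + (2 * h ^ 2) * ⟪ω, e⟫ ^ 2) := by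
    filter_upwards [hsph] with ω hω
    rw [lazy_gossip_pointwise_norm V ω e h hω]
    ring
  rw [integral_congr_ae hae, integral_add (integrable_const _) (hint.const_mul _), integral_const,
    integral_const_mul, hmom e]
  have huniv : ν.real Set.univ = 1 := by simp [Measure.real]
  rw [huniv, one_smul, lazy_gossip_pointwise_norm V ghat e h hg]
  ring

end Summit.AtomisticToContinuum.HydrodynamicLimit.Cruxes.RelEntropyVanishing.IdeatorOne
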